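import Mathlib
import HarnessLib
import Summits.ValiantsHypothesis.ValiantsHypothesis.Theorems.MonotoneRestorationOrbitRestorationQPHomTensor

/-!
# Tensoring with a FIXED weighted target acts diagonally on homomorphism polynomials, with eigenvalue `hom_E(Z)`
# (route MonotoneRestoration, crux `OrbitRestorationQP` stmt-ValiantsHypothesis-18293; span currency / TW-LB programme, piece R9b′)

Namespace `Summit.ValiantsHypothesis.ValiantsHypothesis.Theorems.HomTensor`.  Definition-free.

Specialising the second factor of `homPoly_kronecker` (`…HomTensor.lean`) to a matrix of SCALARS `z : Fin m × Fin m → R` (a fixed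
edge-weighted target on `m` vertices):

* `homPoly_kronecker_eval` — **`hom_E(X ⊗ Z) = hom_E(Z) · hom_E(X)`**: the Kronecker substitution
  `x_{pq} ↦ z_{(e p).2,(e q).2} · x_{(e p).1,(e q).1}` (level `N`, `e : Fin N ≃ Fin n × Fin m`) maps `hom_{E,N}` to the scalar multiple
  `eval z (hom_{E,m}) · hom_{E,n}`.

So on the hom basis of the matrix-symmetric polynomials (`HomSpan`, `HomExpansionUnique`) every such substitution is DIAGONAL; by
Lovász's theorem the eigenvalue vectors `(hom_E(Z))_Z` separate non-isomorphic patterns, which is the isolation mechanism proposed for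
TW-LB (memo CLOSURE-RESIDUE-g9 §6).  Honest label: a classical identity; no stub closed; VP ≠ VNP untouched.
[cite: Lovasz1967, §2; DwivediPagoSeppelt2026, §8]
-/

noncomputable section

open scoped Classical

-- `Summit.ValiantsHypothesis.ValiantsHypothesis.…` is the tree's single-conjunct layout (Sub = Summit).
set_option linter.dupNamespace false

namespace Summit.ValiantsHypothesis.ValiantsHypothesis.Theorems.HomTensor

open MvPolynomial Literature.Computability.AlgebraicComplexity

universe u

/-- **`hom_E(X ⊗ Z) = hom_E(Z) · hom_E(X)` for a fixed weighted target `Z`.** [cite: Lovasz1967, §2] -/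
theorem homPoly_kronecker_eval {A B : Type u} [Fintype A] [DecidableEq A] [Fintype B] [DecidableEq B]
    (E : Multiset (A × B)) {N n m : ℕ} (e : Fin N ≃ Fin n × Fin m) (R : Type*) [CommSemiring R] (z : Fin m × Fin m → R) :
    aeval (fun pq : Fin N × Fin N =>
        (C (z ((e pq.1).2, (e pq.2).2)) * X ((e pq.1).1, (e pq.2).1) : MvPolynomial (Fin n × Fin n) R)) (homPoly E N R) =
      C (eval z (homPoly E m R)) * homPoly E n R := by
  -- specialise the second block of variables of `homPoly_kronecker` to the scalars `z`
  set ρ : MvPolynomial ((Fin n × Fin n) ⊕ (Fin m × Fin m)) R →ₐ[R] MvPolynomial (Fin n × Fin n) R :=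
    aeval (Sum.elim (fun x : Fin n × Fin n => (X x : MvPolynomial (Fin n × Fin n) R))
      (fun y : Fin m × Fin m => (C (z y) : MvPolynomial (Fin n × Fin n) R))) with hρ
  have hcomp : aeval (fun pq : Fin N × Fin N =>
        (C (z ((e pq.1).2, (e pq.2).2)) * X ((e pq.1).1, (e pq.2).1) : MvPolynomial (Fin n × Fin n) R)) =
      ρ.comp (aeval (fun pq : Fin N × Fin N =>
        (X (Sum.inl ((e pq.1).1, (e pq.2).1)) * X (Sum.inr ((e pq.1).2, (e pq.2).2)) :
          MvPolynomial ((Fin n × Fin n) ⊕ (Fin m × Fin m)) R))) := by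
    refine MvPolynomial.algHom_ext fun pq => ?_
    simp only [aeval_X, AlgHom.comp_apply, map_mul, hρ, Sum.elim_inl, Sum.elim_inr]
    exact mul_comm _ _
  rw [hcomp, AlgHom.comp_apply, homPoly_kronecker E e R, map_mul]
  have h1 : ρ (rename Sum.inl (homPoly E n R)) = homPoly E n R := by
    rw [hρ, aeval_rename]
    have : ((Sum.elim (fun x : Fin n × Fin n => (X x : MvPolynomial (Fin n × Fin n) R))
        (fun y : Fin m × Fin m => (C (z y) : MvPolynomial (Fin n × Fin n) R))) ∘ Sum.inl) =
        fun x : Fin n × Fin n => (X x : MvPolynomial (Fin n × Fin n) R) := funext fun _ => rfl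
    rw [this, aeval_X_left_apply]
  have h2 : ρ (rename Sum.inr (homPoly E m R)) = C (eval z (homPoly E m R)) := by
    rw [hρ, aeval_rename]
    have : ((Sum.elim (fun x : Fin n × Fin n => (X x : MvPolynomial (Fin n × Fin n) R))
        (fun y : Fin m × Fin m => (C (z y) : MvPolynomial (Fin n × Fin n) R))) ∘ Sum.inr) =
        fun y : Fin m × Fin m => (C (z y) : MvPolynomial (Fin n × Fin n) R) := funext fun _ => rfl
    have hC : (fun y : Fin m × Fin m => (C (z y) : MvPolynomial (Fin n × Fin n) R)) =
        (C : R →+* MvPolynomial (Fin n × Fin n) R) ∘ z := rfl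
    have key := MvPolynomial.eval₂_comp_left (C : R →+* MvPolynomial (Fin n × Fin n) R) (RingHom.id R) z (homPoly E m R)
    rw [RingHom.comp_id] at key
    rw [this, MvPolynomial.aeval_def, MvPolynomial.algebraMap_eq, hC, ← key]
    rfl
  rw [h1, h2, mul_comm]

end Summit.ValiantsHypothesis.ValiantsHypothesis.Theorems.HomTensor

end
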